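import Summits.Ventures.CertifiedManyBodySolver.Downfold.EmeryShapeTrueCornerRule
import Summits.Ventures.CertifiedManyBodySolver.Downfold.EmeryFermiScalePointsTl1223OPK11TrueCorners
import Summits.Ventures.CertifiedManyBodySolver.Downfold.EmeryFermiScalePointsTl1223OPK11VirtualCorners
import HarnessLib

/-!
# THE ONE-BAND FERMI-SURFACE SHAPE `t′/t` OF THE WHOLE TYPED 3BE BOX `emeryBoxTl1223OPK11Src (EmeryBoxesKSlicesO)` AT ITS TWO TRUE CORNERS (true-corner rule under certified margins, §B.87 (i);
# router/EMERY-SHAPE-CORNERS.tsv «true» rows)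

Venture CertifiedManyBodySolver, cell `pub/hubbard-downfold` (stage S1; INFLATION-RULES-3to1-B §B.87 (i)), seat hubbard-downfold-mod-4 (technique B, g35); namespace
`Summit.Ventures.CertifiedManyBodySolver.Downfold.Emery`. Everything PROVED (0 sorry). WHAT THIS IS NOT: a statement about TlBa₂Ca₂Cu₃O₉ OUTER plane ((K) source box) — the typed box is SCREENING-GRADE; `U = 0`
one-body kinematics of the σ model; object E = the EXACT `t–t′` shape of the σ Fermi surface at the row's own Fermi energy.

For EVERY one-body row of `[1.47, 2.24] × [1.17, 1.38] × [0.61, 0.73] × [0.14, 0.18]` eV the one-band `t′/t` lies between its values at the TRUE corners `(Δ₁, a₁, b₂, c₂)` and `(Δ₂, a₂, b₁, c₁)`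
(`EmeryShapeTrueCornerRule`; the t_pp / t_pp′ directions by the MARGIN LEVERS of `EmeryMarginLevers`, margins certified by `norm_num` with the constants `M` printed below), read
over their K = 384 brackets (`EmeryFermiScalePointsTl1223OPK11TrueCorners`).

| filling | **true-corner window (certified)** | margins (t_pp lower/upper; t_pp′ lower/upper) | two-ray (§B.86 (i)) | g19 sub-box device |
|---|---|---|---|---|
| n_H = 1.14 (ν = 43/100) | **[-0.3325, -0.2558]** | M_b 0.6383 / 2.543; M_c 0.0383 / 0.0 | see EmeryBoxesTl1223OPK11ShapeCorners | [-0.3346,-0.2531] (n_H band) |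
| n_H = 1.18 (ν = 41/100) | **[-0.3325, -0.2561]** | M_b 0.6736 / 2.5786; M_c 0.0 / 0.0 | see EmeryBoxesTl1223OPK11ShapeCorners | [-0.3346,-0.2531] (n_H band) |

Sources: three-band model [HybertsenSchluterChristensen1989, Eq. (1)]; [AndersenEtAl1995, §6]; box rows as cited in the typed object's file.
-/

noncomputable section

namespace Summit.Ventures.CertifiedManyBodySolver.Downfold.Emery

open Real Set

/-- **n_H = 1.14 (ν = 43/100): for every row of the box the one-band Fermi-surface `t′/t` (object E) lies in `[-0.3325, -0.2558]` — its values at the two TRUE corners** (margin levers; margins by `norm_num`). [folklore] -/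
theorem tl1223OPK11Box_fsRatio_true_nH114 {Δ a b c : ℝ} (hΔ : Δ ∈ Icc ((147 : ℝ) / 100) ((56 : ℝ) / 25)) (ha : a ∈ Icc ((117 : ℝ) / 100) ((69 : ℝ) / 50)) (hb : b ∈ Icc ((61 : ℝ) / 100) ((73 : ℝ) / 100)) (hc : c ∈ Icc ((7 : ℝ) / 50) ((9 : ℝ) / 50)) :
    fsRatio Δ a b c (fermiEnergyOf Δ a b c ((43 : ℝ) / 100)) ∈ Icc ((-133 : ℝ) / 400) ((-1279 : ℝ) / 5000) := by
  have hSL := (fermiEnergyOf_of_pointBracketCheck truePt_Tl1223OPK11SL_nH114_br (by norm_num) (by norm_num) (by norm_num) (ν := (43/100 : ℝ)) (by push_cast; exact ⟨le_rfl, le_rfl⟩)).2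
  have hTL := (fermiEnergyOf_of_pointBracketCheck truePt_Tl1223OPK11TL_nH114_br (by norm_num) (by norm_num) (by norm_num) (ν := (43/100 : ℝ)) (by push_cast; exact ⟨le_rfl, le_rfl⟩)).2
  have hSU := (fermiEnergyOf_of_pointBracketCheck truePt_Tl1223OPK11SU_nH114_br (by norm_num) (by norm_num) (by norm_num) (ν := (43/100 : ℝ)) (by push_cast; exact ⟨le_rfl, le_rfl⟩)).2
  have hQU := (fermiEnergyOf_of_pointBracketCheck truePt_Tl1223OPK11QU_nH114_br (by norm_num) (by norm_num) (by norm_num) (ν := (43/100 : ℝ)) (by push_cast; exact ⟨le_rfl, le_rfl⟩)).2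
  have hTH := (fermiEnergyOf_of_pointBracketCheck truePt_Tl1223OPK11TH_nH114_br (by norm_num) (by norm_num) (by norm_num) (ν := (43/100 : ℝ)) (by push_cast; exact ⟨le_rfl, le_rfl⟩)).2
  have hAlo := (fermiEnergyOf_of_pointBracketCheck virtPt_Tl1223OPK11Alo_nH114_br (by norm_num) (by norm_num) (by norm_num) (ν := (43/100 : ℝ)) (by push_cast; exact ⟨le_rfl, le_rfl⟩)).2
  have hTop := (fermiEnergyOf_of_pointBracketCheck virtPt_Tl1223OPK11H_nH114_br (by norm_num) (by norm_num) (by norm_num) (ν := (43/100 : ℝ)) (by push_cast; exact ⟨le_rfl, le_rfl⟩)).2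
  push_cast at hSL hTL hSU hQU hTH hAlo hTop
  norm_num at hSL hTL hSU hQU hTH hAlo hTop
  obtain ⟨hΔl, hΔu⟩ := hΔ
  obtain ⟨hal, hau⟩ := ha
  constructor
  · have hlow := fsRatio_fermiEnergyOf_trueCorner_lower (Δ₁ := ((147 : ℝ) / 100)) (a₁ := ((117 : ℝ) / 100)) (b₁ := ((61 : ℝ) / 100)) (b₂ := ((73 : ℝ) / 100)) (c₁ := ((7 : ℝ) / 50)) (c₂ := ((9 : ℝ) / 50))
      (ν := ((43 : ℝ) / 100)) (pL := ((8033 : ℝ) / 5000)) (qL := ((16977 : ℝ) / 10000)) (Mb := ((6383 : ℝ) / 10000)) (Mc := ((383 : ℝ) / 10000)) (by norm_num) hΔl (by norm_num) hal (by norm_num) hb (by norm_num) hc (by norm_num) (by norm_num) (by norm_num)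
      (by norm_num) hSL.1 hAlo.2 (by norm_num) (by norm_num [fsD, fsN]) (by norm_num) (by norm_num) (by norm_num [fsD, fsN]) (by norm_num) (by norm_num [dopingDisc]) (by norm_num [fsD, fsN])
    refine le_trans ?_ hlow
    have hw := (fsRatio_mem_Icc_on_window_of_dopingDisc_nonpos (Δ := ((147 : ℝ) / 100)) (a := ((117 : ℝ) / 100)) (b := ((73 : ℝ) / 100)) (c := ((9 : ℝ) / 50))
      (p := ((8231 : ℝ) / 5000)) (q := ((4153 : ℝ) / 2500)) (by norm_num) (by norm_num) (by norm_num) (by norm_num) (by norm_num) (by norm_num) (by norm_num) (by norm_num [dopingDisc]) hTL).1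
    refine le_trans ?_ hw
    norm_num [fsRatio, fsD, fsN]
  · have hup := fsRatio_fermiEnergyOf_trueCorner_upper (Δ₁ := ((147 : ℝ) / 100)) (Δ₂ := ((56 : ℝ) / 25)) (a₁ := ((117 : ℝ) / 100)) (a₂ := ((69 : ℝ) / 50)) (b₁ := ((61 : ℝ) / 100)) (b₂ := ((73 : ℝ) / 100)) (c₁ := ((7 : ℝ) / 50)) (c₂ := ((9 : ℝ) / 50))
      (ν := ((43 : ℝ) / 100)) (pU := ((8627 : ℝ) / 5000)) (qU := ((451 : ℝ) / 250)) (qT := ((1299 : ℝ) / 625)) (Mb := ((2543 : ℝ) / 1000)) (Mc := (0 : ℝ)) (by norm_num) ⟨hΔl, hΔu⟩ (by norm_num) ⟨hal, hau⟩ (by norm_num) hb (by norm_num) hc (by norm_num) (by norm_num) (by norm_num)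
      hTop.2 (by norm_num) (by norm_num) hSU.1 hQU.2 (by norm_num) (by norm_num [fsD, fsN]) (by norm_num) (by norm_num) (by norm_num [fsD, fsN]) (by norm_num) (by norm_num) (by norm_num [fsD, fsN])
    refine le_trans hup ?_
    have hw := (fsRatio_mem_Icc_on_window_of_dopingDisc_nonpos (Δ := ((56 : ℝ) / 25)) (a := ((69 : ℝ) / 50)) (b := ((61 : ℝ) / 100)) (c := ((7 : ℝ) / 50))
      (p := ((17591 : ℝ) / 10000)) (q := ((17691 : ℝ) / 10000)) (by norm_num) (by norm_num) (by norm_num) (by norm_num) (by norm_num) (by norm_num) (by norm_num) (by norm_num [dopingDisc]) hTH).2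
    refine le_trans hw ?_
    norm_num [fsRatio, fsD, fsN]

/-- **n_H = 1.18 (ν = 41/100): for every row of the box the one-band Fermi-surface `t′/t` (object E) lies in `[-0.3325, -0.2561]` — its values at the two TRUE corners** (margin levers; margins by `norm_num`). [folklore] -/
theorem tl1223OPK11Box_fsRatio_true_nH118 {Δ a b c : ℝ} (hΔ : Δ ∈ Icc ((147 : ℝ) / 100) ((56 : ℝ) / 25)) (ha : a ∈ Icc ((117 : ℝ) / 100) ((69 : ℝ) / 50)) (hb : b ∈ Icc ((61 : ℝ) / 100) ((73 : ℝ) / 100)) (hc : c ∈ Icc ((7 : ℝ) / 50) ((9 : ℝ) / 50)) :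
    fsRatio Δ a b c (fermiEnergyOf Δ a b c ((41 : ℝ) / 100)) ∈ Icc ((-133 : ℝ) / 400) ((-2561 : ℝ) / 10000) := by
  have hSL := (fermiEnergyOf_of_pointBracketCheck truePt_Tl1223OPK11SL_nH118_br (by norm_num) (by norm_num) (by norm_num) (ν := (41/100 : ℝ)) (by push_cast; exact ⟨le_rfl, le_rfl⟩)).2
  have hTL := (fermiEnergyOf_of_pointBracketCheck truePt_Tl1223OPK11TL_nH118_br (by norm_num) (by norm_num) (by norm_num) (ν := (41/100 : ℝ)) (by push_cast; exact ⟨le_rfl, le_rfl⟩)).2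
  have hSU := (fermiEnergyOf_of_pointBracketCheck truePt_Tl1223OPK11SU_nH118_br (by norm_num) (by norm_num) (by norm_num) (ν := (41/100 : ℝ)) (by push_cast; exact ⟨le_rfl, le_rfl⟩)).2
  have hQU := (fermiEnergyOf_of_pointBracketCheck truePt_Tl1223OPK11QU_nH118_br (by norm_num) (by norm_num) (by norm_num) (ν := (41/100 : ℝ)) (by push_cast; exact ⟨le_rfl, le_rfl⟩)).2
  have hTH := (fermiEnergyOf_of_pointBracketCheck truePt_Tl1223OPK11TH_nH118_br (by norm_num) (by norm_num) (by norm_num) (ν := (41/100 : ℝ)) (by push_cast; exact ⟨le_rfl, le_rfl⟩)).2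
  have hAlo := (fermiEnergyOf_of_pointBracketCheck virtPt_Tl1223OPK11Alo_nH118_br (by norm_num) (by norm_num) (by norm_num) (ν := (41/100 : ℝ)) (by push_cast; exact ⟨le_rfl, le_rfl⟩)).2
  have hTop := (fermiEnergyOf_of_pointBracketCheck virtPt_Tl1223OPK11H_nH118_br (by norm_num) (by norm_num) (by norm_num) (ν := (41/100 : ℝ)) (by push_cast; exact ⟨le_rfl, le_rfl⟩)).2
  push_cast at hSL hTL hSU hQU hTH hAlo hTop
  norm_num at hSL hTL hSU hQU hTH hAlo hTop
  obtain ⟨hΔl, hΔu⟩ := hΔ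
  obtain ⟨hal, hau⟩ := ha
  constructor
  · have hlow := fsRatio_fermiEnergyOf_trueCorner_lower (Δ₁ := ((147 : ℝ) / 100)) (a₁ := ((117 : ℝ) / 100)) (b₁ := ((61 : ℝ) / 100)) (b₂ := ((73 : ℝ) / 100)) (c₁ := ((7 : ℝ) / 50)) (c₂ := ((9 : ℝ) / 50))
      (ν := ((41 : ℝ) / 100)) (pL := ((15669 : ℝ) / 10000)) (qL := ((4131 : ℝ) / 2500)) (Mb := ((421 : ℝ) / 625)) (Mc := (0 : ℝ)) (by norm_num) hΔl (by norm_num) hal (by norm_num) hb (by norm_num) hc (by norm_num) (by norm_num) (by norm_num)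
      (by norm_num) hSL.1 hAlo.2 (by norm_num) (by norm_num [fsD, fsN]) (by norm_num) (by norm_num) (by norm_num [fsD, fsN]) (by norm_num) (by norm_num [dopingDisc]) (by norm_num [fsD, fsN])
    refine le_trans ?_ hlow
    have hw := (fsRatio_mem_Icc_on_window_of_dopingDisc_nonpos (Δ := ((147 : ℝ) / 100)) (a := ((117 : ℝ) / 100)) (b := ((73 : ℝ) / 100)) (c := ((9 : ℝ) / 50))
      (p := ((16009 : ℝ) / 10000)) (q := ((16159 : ℝ) / 10000)) (by norm_num) (by norm_num) (by norm_num) (by norm_num) (by norm_num) (by norm_num) (by norm_num) (by norm_num [dopingDisc]) hTL).1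
    refine le_trans ?_ hw
    norm_num [fsRatio, fsD, fsN]
  · have hup := fsRatio_fermiEnergyOf_trueCorner_upper (Δ₁ := ((147 : ℝ) / 100)) (Δ₂ := ((56 : ℝ) / 25)) (a₁ := ((117 : ℝ) / 100)) (a₂ := ((69 : ℝ) / 50)) (b₁ := ((61 : ℝ) / 100)) (b₂ := ((73 : ℝ) / 100)) (c₁ := ((7 : ℝ) / 50)) (c₂ := ((9 : ℝ) / 50))
      (ν := ((41 : ℝ) / 100)) (pU := ((4221 : ℝ) / 2500)) (qU := ((8811 : ℝ) / 5000)) (qT := ((10147 : ℝ) / 5000)) (Mb := ((12893 : ℝ) / 5000)) (Mc := (0 : ℝ)) (by norm_num) ⟨hΔl, hΔu⟩ (by norm_num) ⟨hal, hau⟩ (by norm_num) hb (by norm_num) hc (by norm_num) (by norm_num) (by norm_num)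
      hTop.2 (by norm_num) (by norm_num) hSU.1 hQU.2 (by norm_num) (by norm_num [fsD, fsN]) (by norm_num) (by norm_num) (by norm_num [fsD, fsN]) (by norm_num) (by norm_num) (by norm_num [fsD, fsN])
    refine le_trans hup ?_
    have hw := (fsRatio_mem_Icc_on_window_of_dopingDisc_nonpos (Δ := ((56 : ℝ) / 25)) (a := ((69 : ℝ) / 50)) (b := ((61 : ℝ) / 100)) (c := ((7 : ℝ) / 50))
      (p := ((17229 : ℝ) / 10000)) (q := ((17329 : ℝ) / 10000)) (by norm_num) (by norm_num) (by norm_num) (by norm_num) (by norm_num) (by norm_num) (by norm_num) (by norm_num [dopingDisc]) hTH).2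
    refine le_trans hw ?_
    norm_num [fsRatio, fsD, fsN]

end Summit.Ventures.CertifiedManyBodySolver.Downfold.Emery
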